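import Summits.CriticalPhenomena.PercolationContinuityZ3.Theorems.Transplant.SkelConcReachHab
import HarnessLib

/-!
# L6 (C), the `hfull` device for the Ω-twins of the kit layer: a plain window over `C.Q y ∪ C.Hfull y du` one row shallower than the
# habitat radii lies in the fresh habitat `Skel.habΩ`

builds on p205010 (kernel theorem, internal audit signed; external expert review pending) — nothing in this file uses p205010.
Status sentence (coordinator 2026-08-20T04:30Z): "θ(p_c) = 0 on ℤ^d, all d ≥ 2 — kernel-verified (Lean 4/Mathlib, standard axioms); internal
adversarial audit SIGNED 2026-08-20 04:29Z; external expert review pending."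
Lane `prim-bschramm-*`, seat `prim-bschramm-p2` (gen 4); helper file (`--supports stmt-CriticalPhenomena-4575`).  Answers p3-g4's design note
(lane INBOX 2026-08-20T20:59:42Z, hypothesis `hfull : Φ.Win root (Icc Lo Hi) Rfill ⊆ Ω` of the Hab kit twins): for Ω = `Skel.habΩ` and every
planar set `P ⊆ C.Q y ∪ C.Hfull y du`, `Φ.Win t P R ⊆ habΩ` as soon as `R + 1 ≤ rQ_α(y)` and `R + 1 ≤ ρ_{a'}(y,du)(ℓ)` for all `ℓ` — by the step
device into the cube span (`Φ.mem_VWin_of_zdAdj`, `PCells.exists_adj_of_mem_Q`) and into the staircase span (`Φ.mem_VStair_of_zdAdj`,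
`PCells.exists_adj_of_mem_Hfull`); both planar pieces are self-adjacent at every point, so no interior margin is needed and a level box
straddling the seam rows `5r | 5r+1` is covered by the pointwise case split.
* `Skel.win_subset_habΩ`.
[cite: KozmaNitzan2024, §4 p. 26 (Q_y, H_{y,du}), Lemma 12 (pp. 23–25)]
-/

noncomputable section

open scoped Classical

namespace Summit.CriticalPhenomena.PercolationContinuityZ3.Theorems

namespace Transplant

namespace Skel

open Literature.Probability.Percolation Literature.Probability.LatticeModels SimpleGraph GadgetSystem ProbeHistory HSiteScheme Contour KNCells
open KNCells.KSchA PlanarSkeletonConc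
open Literature.Barriers.CriticalPhenomena (graphBall graphBall_mono)
open BoxProdZ2 (ConcRadiiG)

variable {V : Type} [DecidableEq V] {G : SimpleGraph V} [G.LocallyFinite] (Φ : PlanarSkeletonConc G)
variable {C : PCells} {t : V} {Λ : ConcRadiiG} {q : unitInterval} {δc : ℝ} {h : ProbeHistory V} {e : Site 2 × MDir} {a' : ℕ} {du : MDir}

/-- **A plain window over `C.Q y ∪ C.Hfull y du`, one row shallower than the habitat radii, lies in the fresh habitat**:
`Φ.Win t P R ⊆ Skel.habΩ … h e a' du` for `P ⊆ C.Q (tgt e) ∪ C.Hfull (tgt e) du`, `R + 1 ≤ rQ_{α}(tgt e)` (`α = aOf₁ h e`) and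
`R + 1 ≤ ρ_{a'}(tgt e, du)(ℓ)` for every `ℓ` (the `hfull` hypothesis of the Ω-twins of the kit layer, with `Rfill := R`). [this work] -/
theorem win_subset_habΩ {P : Finset (Site 2)} (hP : P ⊆ C.Q (tgt e) ∪ C.Hfull (tgt e) du) {R : ℕ}
    (hRQ : R + 1 ≤ Λ.rQ ((⟨cellGeomSG Φ C t Λ, q, δc⟩ : KSchA V ℕ).aOf₁ G h e) (tgt e)) (hRρ : ∀ ℓ, R + 1 ≤ Λ.ρ a' (tgt e) du ℓ) :
    Φ.Win t P R ⊆ habΩ Φ C t (Λ := Λ) q δc h e a' du := by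
  intro v hv
  obtain ⟨hd, hφv⟩ := Φ.mem_Win.1 hv
  rcases Finset.mem_union.1 (hP hφv) with hQ | hH
  · -- the cube piece: step device into `Q_α(y)`
    refine Finset.mem_union_left _ (Finset.mem_union_right _ ?_)
    change v ∈ Φ.VWin t (C.Q (e.1 + stepVec e.2)) (Λ.rQ _ (e.1 + stepVec e.2))
    exact Φ.mem_VWin_of_zdAdj hd hRQ hQ (C.exists_adj_of_mem_Q _ hQ)
  · -- the corridor piece: step device into the staircase span
    refine Finset.mem_union_right _ ?_
    change v ∈ Φ.VStair t (C.Hfull (tgt e) du) (prof C Λ a' (tgt e) du)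
    obtain ⟨t', ht', hadj⟩ := C.exists_adj_of_mem_Hfull (tgt e) du hH
    exact Φ.mem_VStair_of_zdAdj hd hH ⟨t', ht', hadj, hRρ _⟩ (hRρ _)

end Skel

end Transplant

end Summit.CriticalPhenomena.PercolationContinuityZ3.Theorems

end
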